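import Summits.QuantumFields.QCD.Theorems.WilsonMobilityGapMobilityGapSketchFreeReduction
import Summits.QuantumFields.QCD.Theorems.WilsonMobilityGapMobilityGapPositiveMassDecay

/-!
# Line `Sketch` of crux `MobilityGap` (stmt-QuantumFields-9150): the threshold is `O(a_k)` above zero
# (lead c5, 2026-08-16)

Along every admissible datum `d : LineData N_f` the threshold of the clause-(ii) certificate satisfies,
for every large rate `δ`, eventually in `k`,

  `thrD d δ k ≤ (A δ / d.s) · a_k`,  `A` an absolute constant

(`thrD_le_linear`), because the floor `u_k := (A δ / d.s) a_k` is GOOD (`linearFloor_mem_floorSetD`): a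
bare tuple all of whose components are `≥ u_k` is certified flavour by flavour — components `≥ 1/10` by
the landed hopping bound (`ThickCollarFarStability.stub_hopping`, exactly as in `anchorD`), components in
`[u_k, 1/10)` by the DETERMINISTIC positive-mass bound `fm_le_of_pos_mass` of `…PositiveMassDecay`
(rate `c · t_f · s ≥ c u_k s = δ a_k` for `A = 1/c`; the volume condition `t_f (2S+1)⁴ ≥ 1` holds on
all tori `S ≥ L⁰_k = ⌈ℓ_k/a_k⌉` as soon as `a_k³ ≤ (A δ/s)(log 2)⁴`).  This sharpens the necessity
order of the line (lead c3/c4: `thrD ≤ 144 e^{-δ/s}`, and `≤ K a_k` for WITNESSES of the crux) to an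
unconditional statement about the certificate itself: whatever the interacting measure does, the window
in which the three residual laws `stub_lowerAt` / `stub_windowAt` / `stub_deepWindowAt` are asked lies
below `(A δ/s + M) a_k`; the laws have content exactly when `thrD d δ k < 0`, i.e. when the honest
critical point `m_c(β_k) < 0` of the interacting measure is where the certificate fails.
Pure theorem file (no definitions).
-/

noncomputable section

namespace Summit.QuantumFields.QCD.Theorems.MobilityGapSketch

open scoped BigOperators Topology
open MeasureTheory Filter Set
open Literature.MathematicalPhysics.QuantumFieldTheory Literature.MathematicalPhysics.QuantumLattice
  Literature.Probability.LatticeModels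
open Summit.QuantumFields.QCD.Theorems.MobilityGapPositiveMass

variable {Nf : ℕ}

/-- **The linear floor is good.**  There is an absolute constant `A > 0` such that along every admissible
datum `d`, for every large `δ`, eventually in `k`, the floor `(A δ / d.s) · a_k` belongs to the floor set
of the clause-(ii) certificate: every bare tuple with all components `≥ (A δ/d.s) a_k` is certified at
`(d.s, δ, e^{δ})` on all tori `S ≥ L⁰_k` (heavy components by the hopping bound, light positive ones by
the deterministic positive-mass bound). [folklore] -/
theorem linearFloor_mem_floorSetD :
    ∃ A : ℝ, 0 < A ∧ ∀ {Nf : ℕ} (d : LineData Nf),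
      ∀ᶠ δ in atTop, ∀ᶠ k in atTop, A * δ / d.s * d.a k ∈ floorSetD d δ k := by
  obtain ⟨Cp, c, hCp, hc, hposb⟩ := fm_le_of_pos_mass
  refine ⟨1 / c, by positivity, ?_⟩
  intro Nf d
  obtain ⟨Ch, μ, -, hμ, hhop⟩ :=
    Summit.QuantumFields.QCD.Theorems.ThickCollarFarStability.stub_hopping Nf
  have hs := d.s_pos
  have hs1 := d.s_lt_one
  filter_upwards [eventually_ge_atTop (max (max Ch Cp) 1)] with δ hδ
  have hδ1 : 1 ≤ δ := (le_max_right _ 1).trans hδ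
  have hδpos : 0 < δ := one_pos.trans_le hδ1
  have hexpδ : max Ch Cp ≤ Real.exp δ :=
    ((le_max_left _ 1).trans hδ).trans (by have := Real.add_one_le_exp δ; linarith)
  have hChδ : Ch ≤ Real.exp δ := (le_max_left Ch Cp).trans hexpδ
  have hCpδ : Cp ≤ Real.exp δ := (le_max_right Ch Cp).trans hexpδ
  -- the floor
  set u : ℕ → ℝ := fun k => 1 / c * δ / d.s * d.a k with hu
  have hupos : ∀ k, 0 < u k := fun k => by rw [hu]; exact mul_pos (by positivity) (d.a_pos k)
  -- eventual conditions in `k`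
  have hμδ : 0 < μ * d.s / δ := div_pos (mul_pos hμ hs) hδpos
  have hk1 : ∀ᶠ k in atTop, δ * d.a k ≤ μ * d.s := by
    filter_upwards [d.tendsto_a.eventually (eventually_le_nhds hμδ)] with k hk
    calc δ * d.a k ≤ δ * (μ * d.s / δ) := mul_le_mul_of_nonneg_left hk hδpos.le
      _ = μ * d.s := by field_simp
  have hk2 : ∀ᶠ k in atTop, u k ≤ 1 / 10 := by
    have ht : Tendsto u atTop (𝓝 (1 / c * δ / d.s * 0)) := d.tendsto_a.const_mul _
    rw [mul_zero] at ht
    exact ht.eventually (eventually_le_nhds (by norm_num))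
  -- volume: `u_k · (ℓ_k/a_k)⁴ ≥ 1` eventually, from `a_k³ ≤ (δ/(c s)) (log 2)⁴`
  have hlog2 : 0 < Real.log 2 := Real.log_pos (by norm_num)
  have hk3 : ∀ᶠ k in atTop, d.a k ^ 3 ≤ 1 / c * δ / d.s * Real.log 2 ^ 4 := by
    have ht : Tendsto (fun k => d.a k ^ 3) atTop (𝓝 (0 ^ 3)) := d.tendsto_a.pow 3
    rw [zero_pow three_ne_zero] at ht
    exact ht.eventually (eventually_le_nhds (by positivity))
  filter_upwards [hk1, hk2, hk3] with k hk1 hk2 hk3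
  refine ⟨by linarith [hupos k], fun t ht _ S hS f v hv => ?_⟩
  have hv0 : 0 ≤ ‖v‖ := norm_nonneg _
  by_cases hheavy : (1 / 10 : ℝ) ≤ t f
  · -- heavy component: hopping bound, as in `anchorD`
    have h41 : (41 / 10 : ℝ) ≤ |t f + 4| := by
      rw [abs_of_nonneg (by linarith)]; linarith
    have hb := hhop (d.β k) t f h41 S d.s hs hs1 v hv
    calc fm Nf (d.β k) t S f v d.s ≤ Ch * Real.exp (-(μ * d.s * ‖v‖)) := hb
      _ ≤ Real.exp δ * Real.exp (-(δ * (d.a k * ‖v‖))) := by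
          apply mul_le_mul hChδ _ (Real.exp_pos _).le (Real.exp_pos _).le
          apply Real.exp_le_exp.2
          have : δ * (d.a k * ‖v‖) = (δ * d.a k) * ‖v‖ := by ring
          rw [this]
          nlinarith
  · -- light positive component: deterministic positive-mass bound
    push Not at hheavy
    have htf0 : 0 < t f := (hupos k).trans_le (ht f)
    have htf1 : t f ≤ 1 := by linarith
    -- the volume condition on `S ≥ L⁰_k`
    have hvol : 1 ≤ t f * ((2 * S + 1 : ℕ) : ℝ) ^ 4 := by
      have ha := d.a_pos k
      have hfl : Real.log 2 / d.a k ≤ ((2 * S + 1 : ℕ) : ℝ) := by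
        have h1 : d.ell k / d.a k ≤ (d.vfloor k : ℝ) := Nat.le_ceil _
        have h2 : Real.log 2 ≤ d.ell k := by
          unfold LineData.ell
          exact Real.log_le_log (by norm_num) (by linarith [abs_nonneg (Real.log (d.a k))])
        have h3 : (d.vfloor k : ℝ) ≤ ((2 * S + 1 : ℕ) : ℝ) := by
          exact_mod_cast (hS.trans (by omega : S ≤ 2 * S + 1))
        calc Real.log 2 / d.a k ≤ d.ell k / d.a k := div_le_div_of_nonneg_right h2 ha.le
          _ ≤ ((2 * S + 1 : ℕ) : ℝ) := h1.trans h3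
      have hfl4 : (Real.log 2 / d.a k) ^ 4 ≤ ((2 * S + 1 : ℕ) : ℝ) ^ 4 :=
        pow_le_pow_left₀ (by positivity) hfl 4
      have hkey : 1 ≤ u k * (Real.log 2 / d.a k) ^ 4 := by
        rw [hu, div_pow]
        have ha4 : 0 < d.a k ^ 4 := pow_pos ha 4
        rw [show 1 / c * δ / d.s * d.a k * (Real.log 2 ^ 4 / d.a k ^ 4) =
          (1 / c * δ / d.s * Real.log 2 ^ 4) * d.a k / d.a k ^ 4 by ring]
        rw [le_div_iff₀ ha4, one_mul]
        calc d.a k ^ 4 = d.a k ^ 3 * d.a k := by ring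
          _ ≤ (1 / c * δ / d.s * Real.log 2 ^ 4) * d.a k := mul_le_mul_of_nonneg_right hk3 ha.le
      calc (1 : ℝ) ≤ u k * (Real.log 2 / d.a k) ^ 4 := hkey
        _ ≤ t f * ((2 * S + 1 : ℕ) : ℝ) ^ 4 :=
            mul_le_mul (ht f) hfl4 (by positivity) htf0.le
    have hb := hposb Nf (d.β k) t f htf0 htf1 S hvol d.s hs hs1 v hv
    calc fm Nf (d.β k) t S f v d.s ≤ Cp * Real.exp (-(c * t f * d.s * ‖v‖)) := hb
      _ ≤ Real.exp δ * Real.exp (-(δ * (d.a k * ‖v‖))) := by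
          apply mul_le_mul hCpδ _ (Real.exp_pos _).le (Real.exp_pos _).le
          apply Real.exp_le_exp.2
          -- `δ a_k ‖v‖ ≤ c · t_f · s · ‖v‖` since `t_f ≥ u_k = δ a_k/(c s)`
          have h1 : δ * d.a k ≤ c * t f * d.s := by
            have := ht f
            have h2 : 1 / c * δ / d.s * d.a k * (c * d.s) ≤ t f * (c * d.s) :=
              mul_le_mul_of_nonneg_right this (by positivity)
            have h3 : 1 / c * δ / d.s * d.a k * (c * d.s) = δ * d.a k := by field_simp
            linarith
          have := mul_le_mul_of_nonneg_right h1 hv0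
          linarith

/-- **The threshold is `O(a_k)` above zero, unconditionally**: along every admissible datum `d`, for
every large `δ`, eventually in `k`, `thrD d δ k ≤ (A δ / d.s) · a_k`.  Hence the window
`(thrD, thrD + a_k M/Z_m(k)]` in which the residual laws of line `Sketch` are asked lies below
`(A δ/d.s + M) a_k`, and the laws carry content exactly when `thrD d δ k < 0`. [folklore] -/
theorem thrD_le_linear :
    ∃ A : ℝ, 0 < A ∧ ∀ {Nf : ℕ} (d : LineData Nf),
      ∀ᶠ δ in atTop, ∀ᶠ k in atTop, thrD d δ k ≤ A * δ / d.s * d.a k := by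
  obtain ⟨A, hA, h⟩ := linearFloor_mem_floorSetD
  exact ⟨A, hA, fun d => (h d).mono fun δ hδ => hδ.mono fun k hk => thrD_le_of_mem hk⟩

end Summit.QuantumFields.QCD.Theorems.MobilityGapSketch

end
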